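import Literature.Computability.AlgebraicComplexity.BD17OrderingExistsProofs
import HarnessLib

/-!
# Bihan–Dickenstein 2017, Prop. 2.7 (orderings read off the maximal minors) and the Gale-duality
# minors identity (2.11) — PROVED

F. Bihan, A. Dickenstein, *Descartes' rule of signs for polynomial systems supported on circuits*,
Int. Math. Res. Not. IMRN 2017 (22) 6867–6893 = arXiv:1601.05826 [BihanDickenstein2017], §2.2
(held text `paper:arxiv-1601.05826`, p0006:L107–p0007:L3; printed numbering, flat "Proposition 7"
= Prop. 2.7, display (2.11); concordance `pub/val-lit/lit/CONCORDANCE-printed.md § BD17`). THEOREMS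
ONLY; sibling of the statement file `BD17DescartesCircuits.lean` (cell `val-lit`, row X4-BD17), whose
named fact `BD2017_prop_2_7` is DISCHARGED here BY NAME (`BD2017_prop_2_7_holds`), not restated.

The print deduces Prop. 2.7 "immediately" from the well-known Gale-duality identity (2.11): for
full-rank `C ∈ ℝ^{n×(n+2)}`, `B ∈ ℝ^{(n+2)×2}` with `im(B) = ker(C)` "there exists a nonzero real
number `δ` such that `δ det(C(j₁, j₂)) = (−1)^{j₁+j₂} det(P_{j₁}, P_{j₂})`" for `j₁ < j₂` ("stated as
Lemma 2.10 in [MFRCSD13], together with several references", p0006:L111). The print gives no proof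
of (2.11); ours is the classical block-determinant argument:

* `BD17.det_bordered_eq`: the bordered matrix `N = [C; e_{j₁}ᵀ; e_{j₂}ᵀ]` has
  `det N = ∓(−1)^{j₁+j₂} det C(j₁, j₂)` (two Laplace expansions, Mathlib's `Matrix.det_succ_row`;
  the surviving minor is `C(j₁, j₂)` by `Finset.orderEmbOfFin_unique`);
* `BD17.det_bordered_mul_det_aug`: with a right inverse `R` of `C` (`BD17.exists_mul_eq_one`, from
  `rk C = n`) and `C B = 0` (`BD17.mul_eq_zero_of_isGaleDual`),
  `N · [R | B] = [[1, 0], [∗, (P_{j₁}; P_{j₂})]]`, so `det N · det[R | B] = det(P_{j₁}, P_{j₂})`;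
* `BD17.exists_delta_coeffMinor_eq_galeDet`: **(2.11)** in the form valid for all ordered pairs
  `a ≠ b`, `(−1)^{a+b} det C(a,b) (b − a) = δ |b − a| det(P_a, P_b)` with `δ = −1/det[R | B] ≠ 0`
  (`det[R | B] ≠ 0` because not every `det(P_a, P_b)` vanishes for a Gale dual of a rank-`n` matrix,
  `BD17.exists_galeDet_ne_zero` — the kernel is a plane);
* `BD17.exists_isGaleDual`: a Gale dual exists (columns `u, u'`, a basis of `ker C`);
* `BD17.minors_sign_iff`: the displayed sign condition of Prop. 2.7 ⟺ the sign condition of Def. 2.5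
  up to `sign δ`; whence `BD2017_prop_2_7_holds`.

Honest framing: a typed-literature companion (LADDER-VALIANT V1 ideation source); nothing here bears
on VP versus VNP.

## References

* [BihanDickenstein2017] F. Bihan, A. Dickenstein, IMRN 2017 (22) 6867–6893; arXiv:1601.05826,
  §2.2 eq. (2.11), Def. 2.5, Prop. 2.7.
* S. Müller, E. Feliu, G. Regensburger, C. Conradi, A. Shiu, A. Dickenstein, *Sign conditions for
  injectivity of generalized polynomial maps …*, Found. Comput. Math. 16 (2016) 69–97, Lemma 2.10
  (the source of (2.11) as cited in print; not held, not needed).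
-/

noncomputable section

open Matrix Finset

namespace Literature.Computability.AlgebraicComplexity

namespace BD17

variable {n : ℕ}

/-! ### The bordered matrix `[C; e_{j₁}; e_{j₂}]` and its determinant -/

/-- Parity bookkeeping: `(−1)^{(n+1+j₂) + (n+c₀)}` with `c₀` the position of `j₁` in `[n+2] ∖ {j₂}`.
[folklore] -/
private theorem neg_one_pow_border (n a b c : ℕ) (hc : c = if a < b then a else a - 1)
    (hab : a ≠ b) :
    (-1 : ℝ) ^ (n + 1 + b) * (-1) ^ (n + c) = (if a < b then -1 else 1) * (-1) ^ (a + b) := by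
  rw [← pow_add]
  split_ifs at hc ⊢ with h
  · rw [show n + 1 + b + (n + c) = 2 * n + (a + b) + 1 by omega, pow_succ, pow_add, pow_mul,
      neg_one_sq, one_pow, one_mul]
    ring
  · rw [show n + 1 + b + (n + c) = 2 * n + (a + b) by omega, pow_add, pow_mul, neg_one_sq, one_pow]

/-- Laplace expansion of the bordered matrix `N = [C; e_{j₁}ᵀ; e_{j₂}ᵀ] ∈ ℝ^{(n+2)×(n+2)}` along its
two unit rows: `det N = ∓(−1)^{j₁+j₂} det C(j₁, j₂)` (sign `−` iff `j₁ < j₂`).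
[cite: BihanDickenstein2017, §2.2 eq. (2.11) (proof device)] -/
theorem det_bordered_eq (C : Matrix (Fin n) (Fin (n + 2)) ℝ) {j₁ j₂ : Fin (n + 2)} (hne : j₁ ≠ j₂) :
    ((Matrix.fromRows C
        (Matrix.of fun (t : Fin 2) (l : Fin (n + 2)) => if l = ![j₁, j₂] t then (1 : ℝ) else 0)).submatrix
        (finSumFinEquiv (m := n) (n := 2)).symm id).det =
      (if j₁ < j₂ then -1 else 1) * (-1 : ℝ) ^ (j₁.val + j₂.val) * coeffMinor C j₁ j₂ := by
  set N' := (Matrix.fromRows C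
        (Matrix.of fun (t : Fin 2) (l : Fin (n + 2)) => if l = ![j₁, j₂] t then (1 : ℝ) else 0)).submatrix
        (finSumFinEquiv (m := n) (n := 2)).symm id with hN'
  -- the rows of `N'`
  have hlast : (Fin.last (n + 1) : Fin (n + 2)) = Fin.natAdd n (1 : Fin 2) := Fin.ext rfl
  have hmid : (Fin.castSucc (Fin.last n) : Fin (n + 2)) = Fin.natAdd n (0 : Fin 2) := Fin.ext rfl
  have hrow_last : ∀ l, N' (Fin.last (n + 1)) l = if l = j₂ then 1 else 0 := by
    intro l
    rw [hN', Matrix.submatrix_apply, hlast, finSumFinEquiv_symm_apply_natAdd, Matrix.fromRows_apply_inr]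
    simp
  have hrow_mid : ∀ l, N' (Fin.castSucc (Fin.last n)) l = if l = j₁ then 1 else 0 := by
    intro l
    rw [hN', Matrix.submatrix_apply, hmid, finSumFinEquiv_symm_apply_natAdd, Matrix.fromRows_apply_inr]
    simp
  have hrow_top : ∀ (r : Fin n) l, N' (Fin.castSucc (Fin.castSucc r)) l = C r l := by
    intro r l
    have : (Fin.castSucc (Fin.castSucc r) : Fin (n + 2)) = Fin.castAdd 2 r := Fin.ext rfl
    rw [hN', Matrix.submatrix_apply, this, finSumFinEquiv_symm_apply_castAdd, Matrix.fromRows_apply_inl]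
    rfl
  -- first expansion, along the last row `e_{j₂}`
  rw [Matrix.det_succ_row N' (Fin.last (n + 1)), Finset.sum_eq_single j₂]
  rotate_left
  · intro b _ hb
    rw [hrow_last b, if_neg hb]
    ring
  · intro h
    exact absurd (Finset.mem_univ _) h
  rw [hrow_last j₂, if_pos rfl, mul_one, Fin.val_last, Fin.succAbove_last]
  -- second expansion, along the (new) last row `e_{j₁}` restricted off the column `j₂`
  obtain ⟨c₀, hc₀⟩ := Fin.exists_succAbove_eq hne
  set M₁ := N'.submatrix Fin.castSucc j₂.succAbove with hM₁
  have hrowM : ∀ c, M₁ (Fin.last n) c = if c = c₀ then 1 else 0 := by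
    intro c
    rw [hM₁, Matrix.submatrix_apply, hrow_mid, ← hc₀]
    simp only [Fin.succAbove_right_inj]
  rw [Matrix.det_succ_row M₁ (Fin.last n), Finset.sum_eq_single c₀]
  rotate_left
  · intro b _ hb
    rw [hrowM b, if_neg hb]
    ring
  · intro h
    exact absurd (Finset.mem_univ _) h
  rw [hrowM c₀, if_pos rfl, mul_one, Fin.val_last, Fin.succAbove_last]
  -- the remaining minor is `C(j₁, j₂)`
  have hM₂ : M₁.submatrix Fin.castSucc c₀.succAbove =
      C.submatrix id (fun c => j₂.succAbove (c₀.succAbove c)) := by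
    ext r c
    simp only [hM₁, Matrix.submatrix_apply, hrow_top, id]
  have hcard : (univ \ ({j₁, j₂} : Finset (Fin (n + 2)))).card = n := by
    rw [Finset.card_sdiff_of_subset (Finset.subset_univ _), Finset.card_univ, Fintype.card_fin,
      Finset.card_pair hne]
    omega
  have hg : (fun c => j₂.succAbove (c₀.succAbove c)) =
      fun c => (univ \ ({j₁, j₂} : Finset (Fin (n + 2)))).orderEmbOfFin hcard c := by
    have h := Finset.orderEmbOfFin_unique hcard (f := fun c => j₂.succAbove (c₀.succAbove c))
      (fun c => by
        simp only [Finset.mem_sdiff, Finset.mem_univ, Finset.mem_insert, Finset.mem_singleton,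
          true_and, not_or]
        refine ⟨?_, Fin.succAbove_ne _ _⟩
        rw [← hc₀]
        exact fun h => Fin.succAbove_ne _ _ (Fin.succAbove_right_injective h))
      ((Fin.strictMono_succAbove j₂).comp (Fin.strictMono_succAbove c₀))
    rw [h]
  have hminor : (C.submatrix id (fun c => j₂.succAbove (c₀.succAbove c))).det = coeffMinor C j₁ j₂ := by
    rw [hg, coeffMinor, dif_neg hne]
  rw [hM₂, hminor]
  -- signs
  have hc₀val : c₀.val = if j₁ < j₂ then j₁.val else j₁.val - 1 := by
    by_cases h : Fin.castSucc c₀ < j₂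
    · rw [Fin.succAbove_of_castSucc_lt _ _ h] at hc₀
      have h1 : j₁ < j₂ := hc₀ ▸ h
      rw [if_pos h1, ← hc₀]
      rfl
    · rw [not_lt] at h
      rw [Fin.succAbove_of_le_castSucc _ _ h] at hc₀
      have h1 : ¬ j₁ < j₂ := by
        rw [← hc₀, not_lt]
        exact h.trans Fin.castSucc_lt_succ.le
      rw [if_neg h1, ← hc₀]
      simp
  have hsign := neg_one_pow_border n j₁.val j₂.val c₀.val hc₀val (Fin.val_ne_of_ne hne)
  calc (-1 : ℝ) ^ (n + 1 + j₂.val) * ((-1) ^ (n + c₀.val) * coeffMinor C j₁ j₂)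
      = ((-1 : ℝ) ^ (n + 1 + j₂.val) * (-1) ^ (n + c₀.val)) * coeffMinor C j₁ j₂ := by ring
    _ = (if j₁ < j₂ then -1 else 1) * (-1 : ℝ) ^ (j₁.val + j₂.val) * coeffMinor C j₁ j₂ := by
      rw [hsign]
      simp only [Fin.lt_def]

/-- The block identity behind the Gale-duality minors identity: for `C R = 1` and `C B = 0`,
`[C; e_{j₁}ᵀ; e_{j₂}ᵀ] · [R | B] = [[1, 0], [∗, (P_{j₁}; P_{j₂})]]`, hence
`det [C; e_{j₁}ᵀ; e_{j₂}ᵀ] · det [R | B] = det(P_{j₁}, P_{j₂})`.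
[cite: BihanDickenstein2017, §2.2 eq. (2.11) (proof device)] -/
theorem det_bordered_mul_det_aug (C : Matrix (Fin n) (Fin (n + 2)) ℝ)
    (R : Matrix (Fin (n + 2)) (Fin n) ℝ) (B : Matrix (Fin (n + 2)) (Fin 2) ℝ)
    (hR : C * R = 1) (hB : C * B = 0) (j₁ j₂ : Fin (n + 2)) :
    ((Matrix.fromRows C
        (Matrix.of fun (t : Fin 2) (l : Fin (n + 2)) => if l = ![j₁, j₂] t then (1 : ℝ) else 0)).submatrix
        (finSumFinEquiv (m := n) (n := 2)).symm id).det *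
      ((Matrix.fromCols R B).submatrix id (finSumFinEquiv (m := n) (n := 2)).symm).det =
      galeDet B j₁ j₂ := by
  set E := (Matrix.of fun (t : Fin 2) (l : Fin (n + 2)) => if l = ![j₁, j₂] t then (1 : ℝ) else 0)
    with hE
  have hmul := (Matrix.submatrix_mul (Matrix.fromRows C E) (Matrix.fromCols R B)
    (finSumFinEquiv (m := n) (n := 2)).symm id (finSumFinEquiv (m := n) (n := 2)).symm
    Function.bijective_id).symm
  rw [← Matrix.det_mul, hmul, Matrix.det_submatrix_equiv_self, Matrix.fromRows_mul_fromCols, hR, hB,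
    Matrix.det_fromBlocks_zero₁₂, Matrix.det_one, one_mul, Matrix.det_fin_two]
  have hEB : ∀ t s, (E * B) t s = B (![j₁, j₂] t) s := by
    intro t s
    simp [hE, Matrix.mul_apply]
  simp only [hEB, galeDet]
  simp

/-- `rk C = n`: `C` has a right inverse `R`, `C R = 1`. [cite: BihanDickenstein2017, §2.2 (full rank)] -/
theorem exists_mul_eq_one (C : Matrix (Fin n) (Fin (n + 2)) ℝ) (hrk : C.rank = n) :
    ∃ R : Matrix (Fin (n + 2)) (Fin n) ℝ, C * R = 1 := by
  have hsurj : LinearMap.range C.mulVecLin = ⊤ := by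
    apply Submodule.eq_top_of_finrank_eq
    rw [Module.finrank_fin_fun]
    exact hrk
  obtain ⟨g, hg⟩ := LinearMap.exists_rightInverse_of_surjective C.mulVecLin hsurj
  refine ⟨LinearMap.toMatrix' g, ?_⟩
  have h : LinearMap.toMatrix' (C.mulVecLin ∘ₗ g) = 1 := by rw [hg, LinearMap.toMatrix'_id]
  rwa [LinearMap.toMatrix'_comp, ← Matrix.toLin'_apply', LinearMap.toMatrix'_toLin'] at h

/-- The columns of a Gale dual matrix lie in `Ker(C)`: `C B = 0`. [cite: BihanDickenstein2017, §2.2] -/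
theorem mul_eq_zero_of_isGaleDual {C : Matrix (Fin n) (Fin (n + 2)) ℝ}
    {B : Matrix (Fin (n + 2)) (Fin 2) ℝ} (hB : IsGaleDual C B) : C * B = 0 := by
  ext i t
  have ht : (fun j => B j t) ∈ LinearMap.ker C.mulVecLin := by
    rw [← hB]
    exact Submodule.subset_span ⟨t, rfl⟩
  rw [LinearMap.mem_ker, Matrix.mulVecLin_apply] at ht
  have := congr_fun ht i
  simpa [Matrix.mul_apply, Matrix.mulVec, dotProduct] using this

/-- If all `2 × 2` minors `det(P_a, P_b)` of `B` vanish, the columns of `B` span a line, so `B` is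
not a Gale dual of a rank-`n` matrix (whose kernel is a plane). [cite: BihanDickenstein2017, §2.2] -/
theorem exists_galeDet_ne_zero (C : Matrix (Fin n) (Fin (n + 2)) ℝ) (hrk : C.rank = n)
    {B : Matrix (Fin (n + 2)) (Fin 2) ℝ} (hB : IsGaleDual C B) : ∃ a b, galeDet B a b ≠ 0 := by
  by_contra h
  push Not at h
  simp only [galeDet, sub_eq_zero] at h
  -- the two columns of `B` are proportional
  have hline : ∃ v : Fin (n + 2) → ℝ,
      Submodule.span ℝ (Set.range fun t : Fin 2 => fun j : Fin (n + 2) => B j t) ≤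
        Submodule.span ℝ {v} := by
    by_cases h0 : (fun j : Fin (n + 2) => B j 0) = 0
    · refine ⟨fun j => B j 1, Submodule.span_le.mpr ?_⟩
      rintro _ ⟨t, rfl⟩
      fin_cases t
      · simp [h0]
      · exact Submodule.subset_span rfl
    · obtain ⟨a, ha⟩ : ∃ a, B a 0 ≠ 0 := by
        by_contra h'
        push Not at h'
        exact h0 (funext h')
      refine ⟨fun j => B j 0, Submodule.span_le.mpr ?_⟩
      intro x hx
      obtain ⟨t, rfl⟩ := hx
      revert t
      rw [Fin.forall_fin_two]
      refine ⟨Submodule.subset_span rfl, ?_⟩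
      rw [SetLike.mem_coe, Submodule.mem_span_singleton]
      refine ⟨B a 1 / B a 0, funext fun j => ?_⟩
      have := h a j
      simp only [Pi.smul_apply, smul_eq_mul]
      field_simp
      linarith
  obtain ⟨v, hv⟩ := hline
  rw [hB] at hv
  have h2 := finrank_ker_mulVecLin_eq_two C hrk
  have h1 : Module.finrank ℝ (Submodule.span ℝ ({v} : Set (Fin (n + 2) → ℝ))) ≤ 1 := by
    rw [← Finset.coe_singleton]
    exact (finrank_span_finset_le_card _).trans (by simp)
  have := Submodule.finrank_mono hv
  omega

/-- **The Gale-duality minors identity** ("there exists a nonzero real number `δ` such that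
`δ det(C(j₁, j₂)) = (−1)^{j₁+j₂} det(P_{j₁}, P_{j₂})` for all `j₁ < j₂`", p0006:L113–L120, "stated
as Lemma 2.10 in [MFRCSD13]"), here for a rank-`n` matrix `C` and any Gale dual `B`, in the form valid
for all ordered pairs `a ≠ b`:
`(−1)^{a+b} det C(a,b) · (b − a) = δ · |b − a| · det(P_a, P_b)`, `δ ≠ 0`. Proof (ours): the block
identity `det_bordered_mul_det_aug` with a right inverse `R` of `C`, the Laplace expansion
`det_bordered_eq`, and `δ = −1/det[R | B]` (nonzero because not all `det(P_a, P_b)` vanish).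
[cite: BihanDickenstein2017, §2.2 eq. (2.11)] -/
theorem exists_delta_coeffMinor_eq_galeDet (C : Matrix (Fin n) (Fin (n + 2)) ℝ) (hrk : C.rank = n)
    {B : Matrix (Fin (n + 2)) (Fin 2) ℝ} (hB : IsGaleDual C B) :
    ∃ δ : ℝ, δ ≠ 0 ∧ ∀ a b : Fin (n + 2), a ≠ b →
      (-1 : ℝ) ^ (a.val + b.val) * coeffMinor C a b * ((b.val : ℝ) - a.val) =
        δ * |(b.val : ℝ) - a.val| * galeDet B a b := by
  obtain ⟨R, hR⟩ := exists_mul_eq_one C hrk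
  have hCB := mul_eq_zero_of_isGaleDual hB
  set D := ((Matrix.fromCols R B).submatrix id (finSumFinEquiv (m := n) (n := 2)).symm).det with hD
  have key : ∀ a b : Fin (n + 2), a ≠ b →
      (if a < b then -1 else 1) * (-1 : ℝ) ^ (a.val + b.val) * coeffMinor C a b * D = galeDet B a b := by
    intro a b hab
    rw [← det_bordered_eq C hab]
    exact det_bordered_mul_det_aug C R B hR hCB a b
  have hD0 : D ≠ 0 := by
    intro hD0
    obtain ⟨a, b, hab⟩ := exists_galeDet_ne_zero C hrk hB
    by_cases h : a = b
    · subst h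
      exact hab (by rw [galeDet]; ring)
    · rw [← key a b h, hD0, mul_zero] at hab
      exact hab rfl
  refine ⟨-D⁻¹, by simp [hD0], fun a b hab => ?_⟩
  have hk := key a b hab
  have hne : (a.val : ℝ) ≠ b.val := by exact_mod_cast Fin.val_ne_of_ne hab
  rcases lt_or_gt_of_ne hab with h | h
  · rw [if_pos h] at hk
    have hx : (0 : ℝ) < (b.val : ℝ) - a.val := by
      have : (a.val : ℝ) < b.val := by exact_mod_cast h
      linarith
    rw [abs_of_pos hx, ← hk]
    field_simp
  · rw [if_neg (not_lt.mpr h.le)] at hk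
    have hx : (b.val : ℝ) - a.val < 0 := by
      have : (b.val : ℝ) < a.val := by exact_mod_cast h
      linarith
    rw [abs_of_neg hx, ← hk]
    field_simp

/-- A Gale dual matrix exists (its columns a basis `u, u'` of the plane `Ker(C)`).
[cite: BihanDickenstein2017, §2.2] -/
theorem exists_isGaleDual (C : Matrix (Fin n) (Fin (n + 2)) ℝ) (hrk : C.rank = n)
    (hcone : PosConeCond C) : ∃ B, IsGaleDual C B := by
  obtain ⟨u, hupos, hu⟩ := hcone
  have hu0 : u ≠ 0 := by
    intro h
    have := hupos 0
    simp [h] at this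
  obtain ⟨u', hu', hu'span⟩ := exists_mem_ker_not_mem_span C hrk hu0
  refine ⟨Matrix.of fun j t => (![u, u'] : Fin 2 → Fin (n + 2) → ℝ) t j, ?_⟩
  have hfun : (fun t : Fin 2 => fun j : Fin (n + 2) =>
      (Matrix.of fun j t => (![u, u'] : Fin 2 → Fin (n + 2) → ℝ) t j) j t) = ![u, u'] := by
    funext t j
    simp
  unfold IsGaleDual
  rw [hfun]
  have hind : LinearIndependent ℝ (![u, u'] : Fin 2 → Fin (n + 2) → ℝ) := by
    rw [LinearIndependent.pair_iff]
    intro s t hst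
    by_cases ht : t = 0
    · subst ht
      simp only [zero_smul, add_zero] at hst
      exact ⟨(smul_eq_zero.mp hst).resolve_right hu0, rfl⟩
    · exfalso
      apply hu'span
      rw [Submodule.mem_span_singleton]
      refine ⟨-s / t, ?_⟩
      have : t • u' = -(s • u) := eq_neg_of_add_eq_zero_right hst
      calc (-s / t) • u = t⁻¹ • (-(s • u)) := by rw [div_eq_mul_inv, mul_comm, ← smul_smul, neg_smul]
        _ = u' := by rw [← this, smul_smul, inv_mul_cancel₀ ht, one_smul]
  have hle : Submodule.span ℝ (Set.range (![u, u'] : Fin 2 → Fin (n + 2) → ℝ)) ≤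
      LinearMap.ker C.mulVecLin := by
    rw [Submodule.span_le]
    rintro _ ⟨t, rfl⟩
    fin_cases t
    · simpa using hu
    · simpa using hu'
  refine Submodule.eq_of_le_of_finrank_le hle ?_
  rw [finrank_ker_mulVecLin_eq_two C hrk, finrank_span_eq_card hind]
  simp

/-- `det(P_a, P_b) = −det(P_b, P_a)`. [cite: BihanDickenstein2017, Def. 2.5] -/
theorem galeDet_swap (B : Matrix (Fin (n + 2)) (Fin 2) ℝ) (a b : Fin (n + 2)) :
    galeDet B a b = -galeDet B b a := by
  rw [galeDet, galeDet]
  ring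

/-- Under the minors identity, the printed sign condition of Prop. 2.7 on the maximal minors of `C`
is the sign condition of Def. 2.5 on `det(P_{α_i}, P_{α_j})`, `i < j`, up to the sign of `δ`.
[cite: BihanDickenstein2017, Prop. 2.7 (proof)] -/
theorem minors_sign_iff (C : Matrix (Fin n) (Fin (n + 2)) ℝ) (B : Matrix (Fin (n + 2)) (Fin 2) ℝ)
    (α : Equiv.Perm (Fin (n + 2))) {δ : ℝ}
    (hG : ∀ a b : Fin (n + 2), a ≠ b →
      (-1 : ℝ) ^ (a.val + b.val) * coeffMinor C a b * ((b.val : ℝ) - a.val) =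
        δ * |(b.val : ℝ) - a.val| * galeDet B a b)
    (ε : ℝ) :
    (∀ i j : Fin (n + 2), i ≠ j →
        0 ≤ ε * (-1) ^ ((α i).val + (α j).val) * coeffMinor C (α i) (α j) *
          ((((α j).val : ℝ) - (α i).val) / ((j.val : ℝ) - i.val))) ↔
      (∀ i j : Fin (n + 2), i < j → 0 ≤ ε * δ * galeDet B (α i) (α j)) := by
  -- the displayed quantity equals `ε δ |α_j − α_i| det(P_{α_i}, P_{α_j}) / (j − i)`
  have hX : ∀ i j : Fin (n + 2), i ≠ j →
      ε * (-1) ^ ((α i).val + (α j).val) * coeffMinor C (α i) (α j) *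
          ((((α j).val : ℝ) - (α i).val) / ((j.val : ℝ) - i.val)) =
        ε * δ * galeDet B (α i) (α j) * (|((α j).val : ℝ) - (α i).val| / ((j.val : ℝ) - i.val)) := by
    intro i j hij
    have h := hG (α i) (α j) (fun h => hij (α.injective h))
    calc ε * (-1) ^ ((α i).val + (α j).val) * coeffMinor C (α i) (α j) *
          ((((α j).val : ℝ) - (α i).val) / ((j.val : ℝ) - i.val))
        = ε * ((-1) ^ ((α i).val + (α j).val) * coeffMinor C (α i) (α j) *
          (((α j).val : ℝ) - (α i).val)) / ((j.val : ℝ) - i.val) := by ring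
      _ = ε * δ * galeDet B (α i) (α j) * (|((α j).val : ℝ) - (α i).val| / ((j.val : ℝ) - i.val)) := by
          rw [h]
          ring
  have habs : ∀ i j : Fin (n + 2), i ≠ j → (0 : ℝ) < |((α j).val : ℝ) - (α i).val| := by
    intro i j hij
    rw [abs_pos, sub_ne_zero]
    have : (α j).val ≠ (α i).val := Fin.val_ne_of_ne (fun h => hij (α.injective h).symm)
    exact_mod_cast this
  constructor
  · intro hcond i j hij
    have h := hcond i j hij.ne
    rw [hX i j hij.ne] at h
    have hpos : (0 : ℝ) < |((α j).val : ℝ) - (α i).val| / ((j.val : ℝ) - i.val) := by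
      apply div_pos (habs i j hij.ne)
      have : (i.val : ℝ) < j.val := by exact_mod_cast hij
      linarith
    exact nonneg_of_mul_nonneg_left h hpos
  · intro hcond i j hij
    rw [hX i j hij]
    rcases lt_or_gt_of_ne hij with h | h
    · apply mul_nonneg (hcond i j h)
      apply div_nonneg (abs_nonneg _)
      have : (i.val : ℝ) < j.val := by exact_mod_cast h
      linarith
    · have h' := hcond j i h
      rw [galeDet_swap] at h'
      have hji : (j.val : ℝ) - i.val < 0 := by
        have : (j.val : ℝ) < i.val := by exact_mod_cast h
        linarith
      have : ε * δ * galeDet B (α i) (α j) * (|((α j).val : ℝ) - (α i).val| / ((j.val : ℝ) - i.val))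
          = ε * δ * -galeDet B (α i) (α j) * (|((α j).val : ℝ) - (α i).val| / -((j.val : ℝ) - i.val)) := by
        rw [div_neg]
        ring
      rw [this]
      exact mul_nonneg h' (div_nonneg (abs_nonneg _) (neg_nonneg.mpr hji.le))

end BD17

open BD17

/-- **BD 2017, Prop. 2.7 — DISCHARGED** (`theorem BD2017_prop_2_7_holds : BD2017_prop_2_7`): for a
full rank `C ∈ ℝ^{n×(n+2)}` satisfying (1.5), a bijection `α` is an ordering of `C` iff there is
`ε ∈ {1, −1}` with `ε (−1)^{α_i+α_j} det(C(α_i, α_j)) (α_j − α_i)/(j − i) ≥ 0` for all distinct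
`i, j`. Proof as printed ("We immediately deduce" from the Gale-duality minors identity (2.11),
p0006:L107–L124): `BD17.exists_delta_coeffMinor_eq_galeDet` for every Gale dual, a Gale dual exists
(`BD17.exists_isGaleDual`), and `ε` is adjusted by the sign of `δ` (`BD17.minors_sign_iff`).
[cite: BihanDickenstein2017, Prop. 2.7] -/
theorem BD2017_prop_2_7_holds : BD2017_prop_2_7 := by
  intro n C hrk hcone α
  constructor
  · intro hα
    obtain ⟨B₀, hB₀⟩ := exists_isGaleDual C hrk hcone
    obtain ⟨δ, hδ, hG⟩ := exists_delta_coeffMinor_eq_galeDet C hrk hB₀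
    obtain ⟨ε', hε', hord⟩ := hα B₀ hB₀
    rcases lt_or_gt_of_ne hδ with hneg | hpos
    · refine ⟨-ε', by rcases hε' with h | h <;> norm_num [h], ?_⟩
      rw [minors_sign_iff C B₀ α hG]
      intro i j hij
      have h := hord i j hij
      have : -ε' * δ * galeDet B₀ (α i) (α j) = (-δ) * (ε' * galeDet B₀ (α i) (α j)) := by ring
      rw [this]
      exact mul_nonneg (neg_nonneg.mpr hneg.le) h
    · refine ⟨ε', hε', ?_⟩
      rw [minors_sign_iff C B₀ α hG]
      intro i j hij
      have h := hord i j hij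
      have : ε' * δ * galeDet B₀ (α i) (α j) = δ * (ε' * galeDet B₀ (α i) (α j)) := by ring
      rw [this]
      exact mul_nonneg hpos.le h
  · rintro ⟨ε, hε, hcond⟩ B hB
    obtain ⟨δ, hδ, hG⟩ := exists_delta_coeffMinor_eq_galeDet C hrk hB
    rw [minors_sign_iff C B α hG] at hcond
    rcases lt_or_gt_of_ne hδ with hneg | hpos
    · refine ⟨-ε, by rcases hε with h | h <;> norm_num [h], fun i j hij => ?_⟩
      have h := hcond i j hij
      have : -ε * galeDet B (α i) (α j) = (ε * δ * galeDet B (α i) (α j)) / (-δ) := by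
        field_simp
      rw [this]
      exact div_nonneg h (neg_nonneg.mpr hneg.le)
    · refine ⟨ε, hε, fun i j hij => ?_⟩
      have h := hcond i j hij
      have : ε * galeDet B (α i) (α j) = (ε * δ * galeDet B (α i) (α j)) / δ := by
        field_simp
      rw [this]
      exact div_nonneg h hpos.le

end Literature.Computability.AlgebraicComplexity
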